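import Literature.Analysis.FluidPDE.TaoH1LocalExistenceForced
import HarnessLib

/-!
# Tao (2011/2013), Thm. 5.4 WITH FORCING — sanity: the homogeneous case is the unforced fact

Analysis/FluidPDE proof file (theorems only). The specialisation `f = 0`, `B = 0` of the named fact
`tao2011_smooth_local_existence_forced` (`TaoH1LocalExistenceForced.lean`; Tao 2013, Thm. 5.4 =
arXiv:1108.1165 Thm. 31, (ii)+(iv) with forcing) is exactly the tree's unforced named fact
`tao2011_smooth_local_existence` (`TaoH1LocalExistence.lean`, discharged): same absolute constant,
`A² = A'`. This records that the forced rendering has the same shape and normalisations as the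
proved homogeneous one.

## References

* T. Tao, arXiv:1108.1165 = Anal. PDE 6 (2013), Thm. 5.4 = arXiv Thm. 31 (p. 18). [Tao2011]
-/

noncomputable section

open MeasureTheory Set Function Filter Topology
open scoped ENNReal NNReal ContDiff

namespace Literature.Analysis.FluidPDE

/-- The zero force is jointly smooth on every time set. [folklore] -/
private theorem isSmoothSpaceTimeOn_zero_force (S : Set ℝ) :
    FluidPDE.IsSmoothSpaceTimeOn S (0 : ℝ → EuclideanSpace ℝ (Fin 3) → EuclideanSpace ℝ (Fin 3)) :=
  contDiffOn_const

/-- The zero force obeys Tao's Schwartz bounds on every time set (all space–time derivatives within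
the slab vanish). [folklore] -/
private theorem hasUniformRapidDecayOn_zero_force (S : Set ℝ) :
    FluidPDE.HasUniformRapidDecayOn S
      (0 : ℝ → EuclideanSpace ℝ (Fin 3) → EuclideanSpace ℝ (Fin 3)) := by
  intro n K
  refine ⟨0, fun t _ x => ?_⟩
  have h0 : uncurry (0 : ℝ → EuclideanSpace ℝ (Fin 3) → EuclideanSpace ℝ (Fin 3)) =
      fun _ => (0 : EuclideanSpace ℝ (Fin 3)) := by
    funext z; rfl
  rw [h0, iteratedFDerivWithin_fun_zero]
  simp

/-- **Sanity: the homogeneous case of the forced fact is the tree's (discharged) unforced fact.**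
With `f = 0`, `B = 0` and `A² = A'` the hypotheses and the conclusion of
`tao2011_smooth_local_existence_forced` are those of `tao2011_smooth_local_existence` (same
absolute constant `c`). [cite: Tao2011, Thm. 5.4 (ii)+(iv)] -/
theorem tao2011_smooth_local_existence_forced.unforced (h : tao2011_smooth_local_existence_forced) :
    tao2011_smooth_local_existence := by
  obtain ⟨c, hc, hloc⟩ := h
  refine ⟨c, hc, ?_⟩
  intro ν T hν hT u₀ hsm hdiv hHk A hA hH1 hsmall
  have hB : ∀ t ∈ Icc 0 T,
      (∫⁻ x, ‖(0 : ℝ → EuclideanSpace ℝ (Fin 3) → EuclideanSpace ℝ (Fin 3)) t x‖ₑ ^ 2) +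
        (∫⁻ x, ENNReal.ofReal (FluidPDE.frobeniusNormSq
          (fderiv ℝ ((0 : ℝ → EuclideanSpace ℝ (Fin 3) → EuclideanSpace ℝ (Fin 3)) t) x))) ≤
        ENNReal.ofReal ((0 : ℝ) ^ 2) := by
    intro t _
    simp [FluidPDE.frobeniusNormSq]
  have hA' : (∫⁻ x, ‖u₀ x‖ₑ ^ 2) +
      (∫⁻ x, ENNReal.ofReal (FluidPDE.frobeniusNormSq (fderiv ℝ u₀ x))) ≤
        ENNReal.ofReal (Real.sqrt A ^ 2) := by
    rw [Real.sq_sqrt hA]; exact hH1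
  have hsmall' : (Real.sqrt A + 0 * T) ^ 4 * T ≤ c * ν ^ 3 := by
    have e : (Real.sqrt A + 0 * T) ^ 4 = A ^ 2 := by
      rw [zero_mul, add_zero, show (4 : ℕ) = 2 * 2 from rfl, pow_mul, Real.sq_sqrt hA]
    rw [e]; exact hsmall
  exact hloc hν hT hsm hdiv hHk (isSmoothSpaceTimeOn_zero_force _) (hasUniformRapidDecayOn_zero_force _)
    (Real.sqrt_nonneg A) le_rfl hA' hB hsmall'

end Literature.Analysis.FluidPDE

end
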